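import Summits.ResolutionOfSingularities.ResolutionOfSingularities.Theorems.WallLaw2
import Summits.ResolutionOfSingularities.ResolutionOfSingularities.Theorems.PollutionLaw
import Summits.ResolutionOfSingularities.ResolutionOfSingularities.Theorems.WallCutClasses
import Summits.ResolutionOfSingularities.ResolutionOfSingularities.Theorems.MaxContactCutExtinctionCut
import HarnessLib

/-!
# MaxContactCutWallCut — decomp-res node «WallCut» (lens-3 g21, critic row 158), tree file 5/5 of the node

Content VERBATIM from the decomp-res lens-3 g21 node `HOME/decomp-res-lens-3/g21/WallCut.lean` (pin 1e528a76 =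
`parts/…` of HOME/decomp-res-lens-3/g21, 2 135 l; HOME = run/shared/lean/pub/decomp-res; lens imports = tree
`MaxContactCutFreezeCut` +
`StallVertexStraightClasses` only; rc 0 · 0 sorry): its NEW PART ONLY, §W1–§W4 (l. 1330–2120) — the carried block l.
65–1328 (= g20
`ExtinctionCut` c917c20b l. 48–1308, code VERBATIM) is ALREADY in the tree as `FreezeCutDead` · `FreezeCutDead2` ·
`FreezeCutDeadClasses` ·
`MaxContactCutFreezeCutDead` · `ExtinctionCutToric` · `ExtinctionCutToric2` · `ExtinctionCutPort` ·
`MaxContactCutExtinctionCut` and is imported, not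
repeated.  Critic: CRITIC-LEDGER row 158 (2026-08-31T00:37:25Z): 0 · 0 — BOOKED with CONVERSION RESERVED («true
kernel content, land as support»:
THE WALL LAW pins the multiplicities, THE POLLUTION LAW kills the cleaning deficiency, the closing step is the ONE
port at generality δ).  Landing
orders INBOX :569 (lens-3 g21 landing note) and :577 (critic): `--kind proof --supports stmt-ResolutionOfSingularities-31770`
(`MaxContactCut.DefectWalksDeep`); files of the node, in import order: `WallLaw` / `WallLaw2` (§W1, kernel,
namespace `…Theorems.WallCut`, over the
in-cone `FreezeCutDead2` + the toric kernel `ExtinctionCutToric2`) · `PollutionLaw` (§W2, model level, cone-free) ·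
`WallCutClasses` (§W3 the ONE typed
port `BalancedWallPort` with `kollarWallPort_of_balancedWallPort`, and the three §W4 classes; cone-free so that the
route file can cite the port as an
item) · `MaxContactCutWallCut` (§W4 kernels and EXACT iff's at 31770, Theses cone; §M `closes` = tree
`MaxContactCutExponentLadder.closes` verbatim is
omitted, as in `MaxContactCutFreezeCut`).  Aside bookkeeping (rows 156 / 158, INBOX :552 / :577): on the lens-3
column ONE typed PORT item
`WallCut.BalancedWallPort` (g20's `ExtinctionCut.KollarWallPort` is DERIVED from it) and ONE live aside
`FreezeCut.NoSmallDeadStrictHighSkewJointTailsDeep`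
(home `FreezeCutDeadClasses`; mod-port reading LOSSY ∧ WILD-BALANCED, `smallDeadStrict_iff_lossy_wild_of_port`);
decided-mod-port cells are not filed.

## This file

§W4 THE SPLIT BENEATH (KERNEL, in the Theses cone; `open …Theorems.FreezeCut`): `lossy_of_smallDeadStrict` /
`tameBalanced_of_smallDeadStrict` / `wildBalanced_of_smallDeadStrict`, **`smallDeadStrict_of_lossy_tame_wild`** (by
THE WALL LAW) and the EXACT hypothesis-free split **`smallDeadStrict_iff_lossy_tame_wild :
NoSmallDeadStrictHighSkewJointTailsDeep ↔ NoLossyStrictTailsDeep ∧ NoTameBalancedStrictTailsDeep ∧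
NoWildBalancedStrictTailsDeep`**; **`noTameBalancedStrictTails_of_port : BalancedWallPort →
NoTameBalancedStrictTailsDeep`** (TAME-BALANCED EMPTY modulo the ONE EQUIV, by `witnessExtinction`),
`noBalancedBoundaryTails_of_balancedWallPort`, `smallDeadStrict_iff_lossy_wild_of_port`, the EXACT re-locations at
31770 `defectWalksDeep_iff_highPlanar_boundary_lossy_tame_wild` (hypothesis-free) and **`defectWalksDeep_iff_of_port
: BalancedWallPort → (MaxContactCut.DefectWalksDeep ↔ NoFreePointTailsDeep ∧ NoHighPlanarJointTailsDeep ∧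
NoLossyStrictTailsDeep ∧ NoWildBalancedStrictTailsDeep)`**, the lens-5 keys `highSkew_iff_lossy_wild_of_port` /
`skew_iff_lossy_wild_of_port` (`CoefficientCut.NoSkewJointTailsDeep`) / `monomialRegime_iff_lossy_wild_of_port`
(`StallVertex.NoMonomialRegimeSkewStalledTailsDeep`), `lossy_of_defectWalksDeep` / `tameBalanced_of_defectWalksDeep`
/ `wildBalanced_of_defectWalksDeep`, and the honesty lemma `frameRecurrence_oneLetter_not_extinct`.  §M `closes`
omitted (= tree `MaxContactCutExponentLadder.closes`).  Imports `WallLaw2` + `PollutionLaw` + `WallCutClasses` +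
`MaxContactCutExtinctionCut`; 0 sorry.

[WRITER NOTE (decomp-res writer g9): file split only (tree files ≤ 400 lines); namespaces, sections, section
variables and every declaration
exactly as in the lens (the lens's global opens are replayed per file; cone-free files carry the opens of
`FreezeCutClasses.lean`).]

(Sources: Kollar2007 (Lectures on Resolution of Singularities: Thm 1.93, Def 2.56, Rem 2.57, Claim 2.59.1, (2.59.2),
Claim 2.59.4) [corpus:book:kollar2007-lectures-resolution-singularities pp. 54, 92–94]; ZariskiSamuel1960 vol. II
ch. VII §1 Thm 5; CossartJannsenSaito2009 (arXiv:0905.2191 §2); Hauser2010Kangaroo (arXiv:0811.4151); Moh1987;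
CossartPiltant2008 §2.)
-/

noncomputable section

open MvPolynomial Finset
open Literature.AlgebraicGeometry.Resolution
open Literature.AlgebraicGeometry.Resolution.Hauser2010
open Literature.AlgebraicGeometry.Resolution.PointBlowup
open Summit.ResolutionOfSingularities.ResolutionOfSingularities.Theses
open Summit.ResolutionOfSingularities.ResolutionOfSingularities.Theorems.TightDefectClasses
open Summit.ResolutionOfSingularities.ResolutionOfSingularities.Theorems.TightDefectStrongWalks
open Summit.ResolutionOfSingularities.ResolutionOfSingularities.Theorems.ItineraryCutClasses
open Summit.ResolutionOfSingularities.ResolutionOfSingularities.Theorems.BoundaryLedger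
open Summit.ResolutionOfSingularities.ResolutionOfSingularities.Theorems.ProximityCut
open Summit.ResolutionOfSingularities.ResolutionOfSingularities.Theorems.ConeCutAxisLaw
open Literature.AlgebraicGeometry.Resolution.WeightedBlowup
open Literature.Barriers.ResolutionOfSingularities
open Summit.ResolutionOfSingularities.ResolutionOfSingularities.Theorems.FloorCut
open Summit.ResolutionOfSingularities.ResolutionOfSingularities.Theorems.ConeCut
open Summit.ResolutionOfSingularities.ResolutionOfSingularities.Theorems.ExitLaw (fin3_cases eq_of_le_of_degree_le)
open Summit.ResolutionOfSingularities.ResolutionOfSingularities.Theorems.ShadeCut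
open Summit.ResolutionOfSingularities.ResolutionOfSingularities.Theorems.TightCut
open Summit.ResolutionOfSingularities.ResolutionOfSingularities.Theorems.HoleCut

namespace Summit.ResolutionOfSingularities.ResolutionOfSingularities.Theorems.WallCut

open Summit.ResolutionOfSingularities.ResolutionOfSingularities.Theorems.FreezeCut

section Booking

/-- `lossy_of_smallDeadStrict`: Auxiliary step of this node's calculus, VERBATIM from the lens file (see the module
docstring); the statement is its type. [folklore] -/
theorem lossy_of_smallDeadStrict (h : NoSmallDeadStrictHighSkewJointTailsDeep) : NoLossyStrictTailsDeep :=
  fun p hp e he K _ _ _ _ s₀ hs W hW N hN hex hrec htr s hsN h3 h33 hh hskew hsd _ =>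
    h p hp e he K s₀ hs W hW N hN hex hrec htr s hsN h3 h33 hh hskew hsd

/-- `tameBalanced_of_smallDeadStrict`: Auxiliary step of this node's calculus, VERBATIM from the lens file (see the
module docstring); the statement is its type. [folklore] -/
theorem tameBalanced_of_smallDeadStrict (h : NoSmallDeadStrictHighSkewJointTailsDeep) :
    NoTameBalancedStrictTailsDeep :=
  fun p hp e he K _ _ _ _ s₀ hs W hW N hN hex hrec htr s hsN h3 h33 hh hskew hsd _ _ =>
    h p hp e he K s₀ hs W hW N hN hex hrec htr s hsN h3 h33 hh hskew hsd

/-- `wildBalanced_of_smallDeadStrict`: Auxiliary step of this node's calculus, VERBATIM from the lens file (see the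
module docstring); the statement is its type. [folklore] -/
theorem wildBalanced_of_smallDeadStrict (h : NoSmallDeadStrictHighSkewJointTailsDeep) :
    NoWildBalancedStrictTailsDeep :=
  fun p hp e he K _ _ _ _ s₀ hs W hW N hN hex hrec htr s hsN h3 h33 hh hskew hsd _ _ =>
    h p hp e he K s₀ hs W hW N hN hex hrec htr s hsN h3 h33 hh hskew hsd

/-- **THE SPLIT IS EXACT (hypothesis-free): by THE WALL LAW a strict small-dead tail WITHOUT total losses from some
stage on is δ-balanced from the next stage on, tame or wild according to `p ∣ s`.** [new; KERNEL] [folklore] -/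
theorem smallDeadStrict_of_lossy_tame_wild (hL : NoLossyStrictTailsDeep) (hT : NoTameBalancedStrictTailsDeep)
    (hWd : NoWildBalancedStrictTailsDeep) : NoSmallDeadStrictHighSkewJointTailsDeep := by
  intro p hp e he K _ _ _ _ s₀ hs W hW N hN hex hrec htr s hsN h3 h33 hh hskew hsd
  by_cases hloss : ∀ M : ℕ, ∃ t, M ≤ t ∧ ∀ y, y ≠ W.j t → (W.st (t + 1)).r y = 0
  · exact hL p hp e he K s₀ hs W hW N hN hex hrec htr s hsN h3 h33 hh hskew hsd hloss
  push Not at hloss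
  obtain ⟨M, hM⟩ := hloss
  -- no total loss from `M' := max M N` on
  have hTS : TailShade W N s := ⟨hN, hsN, hex⟩
  have hTS' : TailShade W (max M N) s :=
    ⟨fun t ht => hN t (le_trans (le_max_right M N) ht), hTS.shade_eq (max M N) (le_max_right M N),
      fun t ht => hex t (le_trans (le_max_right M N) ht)⟩
  have h2 : ∀ t, max M N ≤ t → ∃ y, y ≠ W.j t ∧ (W.st (t + 1)).r y ≠ 0 := fun t ht =>
    hM t (le_trans (le_max_left M N) ht)
  have hsz : ∀ t, max M N ≤ t → (∀ y, (W.st t).r y + 1 ≤ s) ∧ ∃ x, (W.st t).r x = 0 := fun t ht => by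
    obtain ⟨hsmall, x, hx, -⟩ := hsd t (le_trans (le_max_right M N) ht)
    exact ⟨hsmall, x, hx⟩
  have hbal := balanced_of_twoWalls hs hTS' hsz h2 hrec
  -- rebase to `N'' := max M N + 1`: every stage from there on is δ-balanced
  have hbal' : ∀ t, max M N + 1 ≤ t → ((W.st t).r.degree + 2 * s = 2 * p ^ e ∧
      ∃ x, (W.st t).r x = 0 ∧ ∀ y, y ≠ x → (W.st t).r y + s = p ^ e) := by
    intro t ht
    obtain ⟨t', rfl⟩ : ∃ t', t = t' + 1 := ⟨t - 1, by omega⟩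
    exact hbal t' (by omega)
  have hN'' : N ≤ max M N + 1 := by omega
  by_cases hps : p ∣ s
  · exact hWd p hp e he K s₀ hs W hW (max M N + 1) (fun t ht => hN t (by omega)) (fun t ht => hex t (by omega))
      hrec htr s (hTS.shade_eq _ hN'') h3 h33 hh hskew (fun t ht => hsd t (by omega)) hps hbal'
  · exact hT p hp e he K s₀ hs W hW (max M N + 1) (fun t ht => hN t (by omega)) (fun t ht => hex t (by omega))
      hrec htr s (hTS.shade_eq _ hN'') h3 h33 hh hskew (fun t ht => hsd t (by omega)) hps hbal'

/-- **EXACT: `NoSmallDeadStrictHighSkewJointTailsDeep ≡ LOSSY ∧ TAME-BALANCED ∧ WILD-BALANCED`.** [new; KERNEL] [folklore] -/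
theorem smallDeadStrict_iff_lossy_tame_wild : NoSmallDeadStrictHighSkewJointTailsDeep ↔
    NoLossyStrictTailsDeep ∧ NoTameBalancedStrictTailsDeep ∧ NoWildBalancedStrictTailsDeep :=
  ⟨fun h => ⟨lossy_of_smallDeadStrict h, tameBalanced_of_smallDeadStrict h, wildBalanced_of_smallDeadStrict h⟩,
    fun h => smallDeadStrict_of_lossy_tame_wild h.1 h.2.1 h.2.2⟩

/-- **THE TAME BALANCED STRICT CLASS IS DECIDED (modulo the one port): there is no tame δ-balanced strict tail.**
g20's kernel route VERBATIM: port ↦ word + supports; repeats switch letters (K4) so both letters recur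
(§1 `both_letters_of_switches`); seeds outside `ℕ²` lie in the box `[-s, ∞)²` with `-s ≤ a + b` along their orbits
(BOX, K1a, K2); §1 `witnessExtinction` absorbs every seed orbit in `ℕ²` from a uniform time `T`; isolation (K3) at
stage `T` exhibits a support point outside `ℕ²`, which by K1b descends from a seed — contradiction. [new] [folklore] -/
theorem noTameBalancedStrictTails_of_port (hπ : BalancedWallPort) : NoTameBalancedStrictTailsDeep := by
  intro p hp e he K _ _ _ _ s₀ hs W hW N hN hex hrec htr s hsN h3 h33 hh hskew hsd hps hbal
  have hTS : TailShade W N s := ⟨hN, hsN, hex⟩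
  have hs1 : s + 1 ≤ p ^ e := by
    obtain ⟨hw, -⟩ := hTS.degree_window hs N le_rfl
    have := (hbal N le_rfl).1
    omega
  obtain ⟨N₁, hNN₁, w, S, hsw, hbox, hfwd, hbwd, hσ, hiso⟩ :=
    hπ p hp e K s₀ hs W N hN hrec s hsN (by omega) hs1 (by omega) hps hbal
  have hswitch : ∀ M, ∃ t, M ≤ t ∧ w (t + 1) ≠ w t := by
    intro M
    obtain ⟨t, ht, hst⟩ := hrec (N₁ + M)
    refine ⟨t - N₁, by omega, hsw (t - N₁) ?_⟩
    rwa [Nat.add_sub_cancel' (by omega : N₁ ≤ t)]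
  obtain ⟨hU, hV⟩ := ExtinctionCut.both_letters_of_switches w hswitch
  set A : Set (ℤ × ℤ) := {x | ∃ i, i ≤ s ∧ x ∈ S i 0 ∧ ¬ ExtinctionCut.InQuad x} with hA
  have hboxA : ∀ x ∈ A, -(s : ℤ) ≤ x.1 ∧ -(s : ℤ) ≤ x.2 := by
    rintro x ⟨i, hi, hx, -⟩
    obtain ⟨h1, h2⟩ := hbox i hi x hx
    constructor <;> omega
  have hσA : ∀ x ∈ A, ∀ t, -(s : ℤ) ≤ (ExtinctionCut.orbit w x t).1 + (ExtinctionCut.orbit w x t).2 := by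
    rintro x ⟨i, hi, hx, -⟩ t
    by_cases hq' : ExtinctionCut.InQuad (ExtinctionCut.orbit w x t)
    · unfold ExtinctionCut.InQuad at hq'; omega
    · have := hσ i hi t _ (ExtinctionCut.orbit_mem_of_not_inQuad (hfwd i hi) hx t hq'); omega
  obtain ⟨T, hT⟩ := ExtinctionCut.witnessExtinction s w hU hV A hboxA hσA
  obtain ⟨i, hi, y, hy, hyq⟩ := hiso T
  obtain ⟨x, hx0, hxq, hxt⟩ := ExtinctionCut.exists_seed_of_not_inQuad (hbwd i hi) T y hy hyq
  exact hyq (hxt ▸ hT x ⟨i, hi, hx0, hxq⟩ T le_rfl)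

/-- g20's boundary class, now from the balanced port (ONE EQUIV for both nodes). [new] [folklore] -/
theorem noBalancedBoundaryTails_of_balancedWallPort (hπ : BalancedWallPort) : NoBalancedBoundaryTailsDeep :=
  ExtinctionCut.noBalancedBoundaryTails_of_port (kollarWallPort_of_balancedWallPort hπ)

/-- **EXACT RE-LOCATION of the strict residual modulo the port: `NoSmallDeadStrictHighSkewJointTailsDeep ≡ LOSSY ∧
WILD-BALANCED`.** [new] [folklore] -/
theorem smallDeadStrict_iff_lossy_wild_of_port (hπ : BalancedWallPort) :
    NoSmallDeadStrictHighSkewJointTailsDeep ↔ NoLossyStrictTailsDeep ∧ NoWildBalancedStrictTailsDeep :=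
  smallDeadStrict_iff_lossy_tame_wild.trans
    ⟨fun h => ⟨h.1, h.2.2⟩, fun h => ⟨h.1, noTameBalancedStrictTails_of_port hπ, h.2⟩⟩

/-- **EXACT RE-LOCATION OF THE HOST ASIDE 31770 (`MaxContactCut.DefectWalksDeep`), hypothesis-free form after g21:**
free-point tails, high planar joint tails, balanced boundary tails, and the three strict classes. [new; KERNEL] [folklore] -/
theorem defectWalksDeep_iff_highPlanar_boundary_lossy_tame_wild : MaxContactCut.DefectWalksDeep ↔
    NoFreePointTailsDeep ∧ NoHighPlanarJointTailsDeep ∧ NoBalancedBoundaryTailsDeep ∧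
      NoLossyStrictTailsDeep ∧ NoTameBalancedStrictTailsDeep ∧ NoWildBalancedStrictTailsDeep :=
  defectWalksDeep_iff_highPlanar_balanced_smallDeadStrict.trans
    ⟨fun h => ⟨h.1, h.2.1, h.2.2.1, smallDeadStrict_iff_lossy_tame_wild.mp h.2.2.2⟩,
      fun h => ⟨h.1, h.2.1, h.2.2.1, smallDeadStrict_iff_lossy_tame_wild.mpr h.2.2.2⟩⟩

/-- **EXACT RE-LOCATION OF THE HOST ASIDE 31770 modulo the ONE EQUIV: the residual of the skew joint axis is
`LOSSY ∧ WILD-BALANCED`** (both tame balanced classes — g20's boundary one and g21's strict one — discharged by the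
same port + the same kernel extinction theorem). [new] [folklore] -/
theorem defectWalksDeep_iff_of_port (hπ : BalancedWallPort) :
    MaxContactCut.DefectWalksDeep ↔
      NoFreePointTailsDeep ∧ NoHighPlanarJointTailsDeep ∧ NoLossyStrictTailsDeep ∧ NoWildBalancedStrictTailsDeep :=
  defectWalksDeep_iff_highPlanar_boundary_lossy_tame_wild.trans
    ⟨fun h => ⟨h.1, h.2.1, h.2.2.2.1, h.2.2.2.2.2⟩, fun h =>
      ⟨h.1, h.2.1, noBalancedBoundaryTails_of_balancedWallPort hπ, h.2.2.1, noTameBalancedStrictTails_of_port hπ,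
        h.2.2.2⟩⟩

/-- EXACT, high-skew form (g19 K7 `highSkew_iff_balanced_smallDeadStrict`), modulo the port. [new] [folklore] -/
theorem highSkew_iff_lossy_wild_of_port (hπ : BalancedWallPort) :
    NoHighSkewJointTailsDeep ↔ NoLossyStrictTailsDeep ∧ NoWildBalancedStrictTailsDeep :=
  (ExtinctionCut.highSkew_iff_smallDeadStrict_of_port (kollarWallPort_of_balancedWallPort hπ)).trans
    (smallDeadStrict_iff_lossy_wild_of_port hπ)

/-- EXACT, keyed to lens-5's coefficient class `CoefficientCut.NoSkewJointTailsDeep`, modulo the port. [new] [folklore] -/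
theorem skew_iff_lossy_wild_of_port (hπ : BalancedWallPort) :
    CoefficientCut.NoSkewJointTailsDeep ↔ NoLossyStrictTailsDeep ∧ NoWildBalancedStrictTailsDeep :=
  (ExtinctionCut.skew_iff_smallDeadStrict_of_port (kollarWallPort_of_balancedWallPort hπ)).trans
    (smallDeadStrict_iff_lossy_wild_of_port hπ)

/-- EXACT, keyed to lens-5's landed monomial-regime class (`StallVertex.skew_iff_monomialRegime`,
`Theorems/StallVertexStraightClasses.lean`), modulo the port. [new] [folklore] -/
theorem monomialRegime_iff_lossy_wild_of_port (hπ : BalancedWallPort) :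
    StallVertex.NoMonomialRegimeSkewStalledTailsDeep ↔ NoLossyStrictTailsDeep ∧ NoWildBalancedStrictTailsDeep :=
  StallVertex.skew_iff_monomialRegime.symm.trans (skew_iff_lossy_wild_of_port hπ)

/-- The unconditional directions (sanity: the three classes are CONSEQUENCES of the host aside). [new] [folklore] -/
theorem lossy_of_defectWalksDeep (h : MaxContactCut.DefectWalksDeep) : NoLossyStrictTailsDeep :=
  (defectWalksDeep_iff_highPlanar_boundary_lossy_tame_wild.mp h).2.2.2.1

/-- `tameBalanced_of_defectWalksDeep`: Auxiliary step of this node's calculus, VERBATIM from the lens file (see the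
module docstring); the statement is its type. [folklore] -/
theorem tameBalanced_of_defectWalksDeep (h : MaxContactCut.DefectWalksDeep) : NoTameBalancedStrictTailsDeep :=
  (defectWalksDeep_iff_highPlanar_boundary_lossy_tame_wild.mp h).2.2.2.2.1

/-- `wildBalanced_of_defectWalksDeep`: Auxiliary step of this node's calculus, VERBATIM from the lens file (see the
module docstring); the statement is its type. [folklore] -/
theorem wildBalanced_of_defectWalksDeep (h : MaxContactCut.DefectWalksDeep) : NoWildBalancedStrictTailsDeep :=
  (defectWalksDeep_iff_highPlanar_boundary_lossy_tame_wild.mp h).2.2.2.2.2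

/-- HONESTY (what the deciding argument consumes).  (1) The port data are consistent for a one-letter word
(`ExtinctionCut.portData_consistent_constantWord`, g20): the contradiction in `noTameBalancedStrictTails_of_port`
consumes the class binder «proximity repeats beyond every bound» (via K4).  (2) THE WALL LAW consumes BOTH «repeats
beyond every bound» (a repeat is a letter switch of the frame word; with one letter the frame orbit `Uᵏ(ν, κ) =
(ν + kκ, κ)` with `κ = 0`, `ν < 0` is a bounded non-balanced solution of the frame recurrence) AND «no total loss»
(the strict cells' ledger has skew unbalanced cycles through total losses, e.g. `{2,1} → {2,0} → {2,1}` at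
`(p^e, s) = (4, 3)` — the LOSSY residual is genuine).  Recorded here as the arithmetic fact behind (2): [folklore] -/
theorem frameRecurrence_oneLetter_not_extinct (ν : ℤ) (hν : ν < 0) (k : ℕ) :
    ¬ ExtinctionCut.InQuad (ExtinctionCut.orbit (fun _ => true) (ν, 0) k) := by
  have : ExtinctionCut.orbit (fun _ => true) (ν, 0) k = (ν, 0) := by
    induction k with
    | zero => rfl
    | succ k ih => rw [ExtinctionCut.orbit_succ, ih]; show (ν + 0, (0 : ℤ)) = (ν, 0); rw [add_zero]
  rw [this]
  unfold ExtinctionCut.InQuad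
  push Not
  intro h
  exact absurd h (not_le.mpr hν)

end Booking

end Summit.ResolutionOfSingularities.ResolutionOfSingularities.Theorems.WallCut
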